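import Summits.CriticalPhenomena.PercolationContinuityZ3.Theorems.PercNearOneGluingNoHeavyLowerTailSahiGridPatternOrthantGrid

/-!
# `NoHeavyLowerTail` (crux stmt-CriticalPhenomena-4575), Sahi programme: **TWO CYLINDER SLOTS OVER THE SAME BLOCK — measurable test sets suffice,
# EVERY DIMENSION** (the third slot of the pattern inequality sees only the block-marginal of the test set)

Support file (seat `prim-sahi-p1`, generation 10; `--supports stmt-CriticalPhenomena-4575`).  Pure proofs, no definitions, no `sorry`, standard axioms.
Vocabulary of `…SahiGridPattern{,Tensor,AllDim}` (`Pd`, `sStarD`, `tcD`, `c1 c2 c3`, `sStarD_eq_sum_tcD`).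

THE MATHEMATICS.  `P_d = [3]^d`, `J ⊆ [d]`; `X ⊆ P_d` is `J`-MEASURABLE if membership depends only on the coordinates in `J` (a cylinder over the block `J`).
**THEOREM (`sStarD_nonneg_of_twoCylinders`, every `d`, every `J`).**  Let `A, B ⊆ P_d` be `J`-measurable (no up-set hypothesis needed on them).  If
`0 ≤ sStarD A B U` for every `J`-measurable UP-SET `U`, then `0 ≤ sStarD A B C` for EVERY up-set `C ⊆ P_d`.
So for two cylinder slots over a common block the pattern inequality reduces to the block: with `A = A_J × [3]^{Jᶜ}`, `B = B_J × [3]^{Jᶜ}` the hypothesis is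
`6^{|Jᶜ|}·sStarD_{|J|}(A_J,B_J,U_J) ≥ 0`, i.e. `PatternPos |J|` restricted to the pair `(A_J,B_J)`; in particular (PatternPos `≤ 4` being settled) every triple in which
TWO of the three up-sets depend on the same `≤ 4` coordinates satisfies the pattern inequality in every dimension (for `|J| ≤ 2` already one such slot suffices,
`…TwoCoord`; the formal discharge of the hypothesis from `patternPos_three'` needs the block re-indexing and is not done here).
PROOF.  (1) VALUE-RELABELLING INVARIANCE (`tcD_valuePerm`): the pattern tensor `tcD p q r` is a signed sum of products over the axes of the equality-pattern counts
`c1, c2, c3`, so it is invariant under an arbitrary permutation of the three VALUES in each axis applied to `p, q, r` simultaneously (no monotonicity involved).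
(2) Hence the profile `g(r) := Σ_{p∈A, q∈B} tcD p q r` of two `J`-measurable sets depends only on `r|_J` (`pairProfile_eq_of_agree`): relabel the values off `J` so as
to move `r` to `r'`, which fixes `A` and `B`.  (3) `sStarD A B C = Σ_{r∈C} g(r)` and, with `N_C(r) := #{r' ∈ C : r'|_J = r|_J}` (a `J`-measurable function, MONOTONE
because `C` is an up-set: `r' ↦ (s on J, r' off J)` injects the fibre over `r|_J` into the fibre over `s|_J ⊇`), `κ·sStarD A B C = Σ_r g(r)·N_C(r)` where `κ = 3^{d−|J|}`
is the common size of the classes `{x : x|_J = r|_J}` (`card_agreeClass_eq`); (4) LAYER CAKE: `N_C = Σ_{t ≥ 0} 1[N_C > t]` and each `U_t = {N_C > t}` is a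
`J`-measurable up-set, so `κ·sStarD A B C = Σ_t sStarD A B U_t ≥ 0`.  ∎
HONEST LABEL: a reduction, not a new case of `PatternPos` by itself; `PatternPos d` (`d ≥ 5`), Sahi's `C₃` and Kahn's conjecture remain OPEN. [this work]
-/

namespace Summit.CriticalPhenomena.PercolationContinuityZ3.Theorems.SahiGridPattern

open Finset SahiGrid3
open scoped BigOperators

variable {d : ℕ}

/-! ### Value-relabelling invariance of the pattern tensor -/

/-- `c1` is invariant under relabelling the values. [this work] -/
theorem c1_perm (σ : Equiv.Perm (Fin 3)) (u v w : Fin 3) : c1 (σ u) (σ v) (σ w) = c1 u v w := by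
  unfold c1; simp only [σ.injective.eq_iff]

/-- `c2` is invariant under relabelling the values. [this work] -/
theorem c2_perm (σ : Equiv.Perm (Fin 3)) (u v w : Fin 3) : c2 (σ u) (σ v) (σ w) = c2 u v w := by
  unfold c2; simp only [ne_eq, σ.injective.eq_iff]

/-- `c3` is invariant under relabelling the values. [this work] -/
theorem c3_perm (σ : Equiv.Perm (Fin 3)) (u v w : Fin 3) : c3 (σ u) (σ v) (σ w) = c3 u v w := by
  unfold c3; simp only [ne_eq, σ.injective.eq_iff]

/-- **The pattern tensor is invariant under an arbitrary relabelling of the values in each axis** (applied to all three arguments). [this work] -/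
theorem tcD_valuePerm (σ : Fin d → Equiv.Perm (Fin 3)) (p q r : Pd d) :
    tcD (fun a => σ a (p a)) (fun a => σ a (q a)) (fun a => σ a (r a)) = tcD p q r := by
  unfold tcD
  simp only [c1_perm, c2_perm, c3_perm]

/-! ### The profile of two `J`-measurable slots depends only on the `J`-coordinates -/

/-- **Pair profile.**  For `J`-measurable `A, B` the profile `r ↦ Σ_{p∈A, q∈B} tcD p q r` depends only on `r|_J`. [this work] -/
theorem pairProfile_eq_of_agree (J : Finset (Fin d)) {A B : Finset (Pd d)}
    (hA : ∀ x y : Pd d, (∀ a ∈ J, x a = y a) → (x ∈ A ↔ y ∈ A)) (hB : ∀ x y : Pd d, (∀ a ∈ J, x a = y a) → (x ∈ B ↔ y ∈ B))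
    {r r' : Pd d} (hrr' : ∀ a ∈ J, r a = r' a) :
    (∑ p ∈ A, ∑ q ∈ B, tcD p q r) = ∑ p ∈ A, ∑ q ∈ B, tcD p q r' := by
  classical
  -- relabel the values off `J` so that `r ↦ r'`
  let σ : Fin d → Equiv.Perm (Fin 3) := fun a => if a ∈ J then 1 else Equiv.swap (r a) (r' a)
  let Φ : Pd d ≃ Pd d :=
    { toFun := fun x a => σ a (x a)
      invFun := fun x a => (σ a).symm (x a)
      left_inv := fun x => funext fun a => by simp
      right_inv := fun x => funext fun a => by simp }
  have hσJ : ∀ a ∈ J, ∀ u : Fin 3, σ a u = u := fun a ha u => by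
    show (if a ∈ J then (1 : Equiv.Perm (Fin 3)) else Equiv.swap (r a) (r' a)) u = u
    rw [if_pos ha]; rfl
  have hΦr : Φ r = r' := by
    funext a
    show (if a ∈ J then (1 : Equiv.Perm (Fin 3)) else Equiv.swap (r a) (r' a)) (r a) = r' a
    by_cases ha : a ∈ J
    · rw [if_pos ha]; exact hrr' a ha
    · rw [if_neg ha, Equiv.swap_apply_left]
  have hΦA : ∀ x : Pd d, x ∈ A ↔ Φ x ∈ A := fun x => hA x (Φ x) fun a ha => (hσJ a ha (x a)).symm
  have hΦB : ∀ x : Pd d, x ∈ B ↔ Φ x ∈ B := fun x => hB x (Φ x) fun a ha => (hσJ a ha (x a)).symm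
  rw [← hΦr]
  symm
  calc (∑ p ∈ A, ∑ q ∈ B, tcD p q (Φ r))
      = ∑ p ∈ A, ∑ q ∈ B, tcD (Φ p) (Φ q) (Φ r) := by
        refine Finset.sum_equiv Φ.symm (fun p => ?_) fun p _ => ?_
        · rw [hΦA (Φ.symm p), Equiv.apply_symm_apply]
        · rw [Equiv.apply_symm_apply]
          refine Finset.sum_equiv Φ.symm (fun q => ?_) fun q _ => ?_
          · rw [hΦB (Φ.symm q), Equiv.apply_symm_apply]
          · rw [Equiv.apply_symm_apply]
    _ = ∑ p ∈ A, ∑ q ∈ B, tcD p q r :=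
        Finset.sum_congr rfl fun p _ => Finset.sum_congr rfl fun q _ => tcD_valuePerm σ p q r

/-- `sStarD A B C` is the sum of the pair profile over `C`. [this work] -/
theorem sStarD_eq_sum_pairProfile (A B C : Finset (Pd d)) :
    sStarD A B C = ∑ r ∈ C, ∑ p ∈ A, ∑ q ∈ B, tcD p q r := by
  rw [sStarD_eq_sum_tcD, Finset.sum_congr rfl fun p _ => Finset.sum_comm, Finset.sum_comm]

/-! ### The classes `{x : x|_J = r|_J}` and the fibre counts of an up-set -/

/-- All classes `{x : x|_J = r|_J}` have the same size. [this work] -/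
theorem card_agreeClass_eq (J : Finset (Fin d)) (r s : Pd d) :
    (univ.filter fun x : Pd d => ∀ a ∈ J, x a = r a).card = (univ.filter fun x : Pd d => ∀ a ∈ J, x a = s a).card := by
  classical
  refine Finset.card_bij' (fun x _ => fun a => if a ∈ J then s a else x a) (fun x _ => fun a => if a ∈ J then r a else x a) ?_ ?_ ?_ ?_
  · intro x _
    simp only [Finset.mem_filter, Finset.mem_univ, true_and]
    intro a ha; rw [if_pos ha]
  · intro x _
    simp only [Finset.mem_filter, Finset.mem_univ, true_and]
    intro a ha; rw [if_pos ha]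
  · intro x hx
    simp only [Finset.mem_filter, Finset.mem_univ, true_and] at hx
    funext a
    by_cases ha : a ∈ J
    · simp only [ha, if_true]; exact (hx a ha).symm
    · simp only [ha, if_false]
  · intro x hx
    simp only [Finset.mem_filter, Finset.mem_univ, true_and] at hx
    funext a
    by_cases ha : a ∈ J
    · simp only [ha, if_true]; exact (hx a ha).symm
    · simp only [ha, if_false]

/-- The fibre counts `N_C(r) = #{r' ∈ C : r'|_J = r|_J}` of an up-set are monotone in `r`. [this work] -/
theorem fibreCount_mono (J : Finset (Fin d)) {C : Finset (Pd d)} (hC : IsUpperSet (C : Set (Pd d))) {r s : Pd d} (hrs : r ≤ s) :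
    (C.filter fun x : Pd d => ∀ a ∈ J, x a = r a).card ≤ (C.filter fun x : Pd d => ∀ a ∈ J, x a = s a).card := by
  classical
  refine Finset.card_le_card_of_injOn (fun x => fun a => if a ∈ J then s a else x a) (fun x hx => ?_) (fun x hx x' hx' h => ?_)
  · rw [Finset.mem_coe, Finset.mem_filter] at hx
    rw [Finset.mem_coe, Finset.mem_filter]
    refine ⟨hC (show x ≤ fun a => if a ∈ J then s a else x a from fun a => ?_) hx.1, fun a ha => by simp only [ha, if_true]⟩
    by_cases ha : a ∈ J
    · simp only [ha, if_true]; rw [hx.2 a ha]; exact hrs a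
    · simp only [ha, if_false]; exact le_rfl
  · rw [Finset.mem_coe, Finset.mem_filter] at hx hx'
    funext a
    by_cases ha : a ∈ J
    · rw [hx.2 a ha, hx'.2 a ha]
    · have := congrFun h a
      simp only [ha, if_false] at this
      exact this

/-! ### The theorem -/

/-- **TWO CYLINDER SLOTS OVER THE SAME BLOCK: measurable test sets suffice** (every `d`, every block `J`).  If `A, B ⊆ [3]^d` are `J`-measurable and
`0 ≤ sStarD A B U` for every `J`-measurable up-set `U`, then `0 ≤ sStarD A B C` for every up-set `C`. [this work] -/
theorem sStarD_nonneg_of_twoCylinders (J : Finset (Fin d)) {A B : Finset (Pd d)}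
    (hA : ∀ x y : Pd d, (∀ a ∈ J, x a = y a) → (x ∈ A ↔ y ∈ A)) (hB : ∀ x y : Pd d, (∀ a ∈ J, x a = y a) → (x ∈ B ↔ y ∈ B))
    (hgood : ∀ U : Finset (Pd d), IsUpperSet (U : Set (Pd d)) → (∀ x y : Pd d, (∀ a ∈ J, x a = y a) → (x ∈ U ↔ y ∈ U)) → 0 ≤ sStarD A B U)
    (C : Finset (Pd d)) (hC : IsUpperSet (C : Set (Pd d))) : 0 ≤ sStarD A B C := by
  classical
  -- the profile `g`, the fibre counts `N`, the class size `κ`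
  obtain ⟨g, hgdef⟩ : ∃ g : Pd d → ℤ, ∀ r, g r = ∑ p ∈ A, ∑ q ∈ B, tcD p q r := ⟨_, fun r => rfl⟩
  obtain ⟨N, hNdef⟩ : ∃ N : Pd d → ℕ, ∀ r, N r = (C.filter fun x : Pd d => ∀ a ∈ J, x a = r a).card := ⟨_, fun r => rfl⟩
  obtain ⟨κ, hκdef⟩ : ∃ κ : ℕ, κ = (univ.filter fun x : Pd d => ∀ a ∈ J, x a = (fun _ : Fin d => (0 : Fin 3)) a).card := ⟨_, rfl⟩
  have hκ : ∀ r : Pd d, (univ.filter fun x : Pd d => ∀ a ∈ J, x a = r a).card = κ := fun r => by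
    rw [hκdef]; exact card_agreeClass_eq J r _
  have hκpos : 0 < κ := by
    rw [← hκ (fun _ => 0)]
    exact Finset.card_pos.2 ⟨fun _ => 0, by simp⟩
  have hg : ∀ r r' : Pd d, (∀ a ∈ J, r a = r' a) → g r = g r' := fun r r' h => by
    rw [hgdef, hgdef]; exact pairProfile_eq_of_agree J hA hB h
  have hSg : ∀ X : Finset (Pd d), sStarD A B X = ∑ r ∈ X, g r := fun X => by
    rw [sStarD_eq_sum_pairProfile]; exact Finset.sum_congr rfl fun r _ => (hgdef r).symm
  -- `κ · sStarD A B C = Σ_r g(r) · N(r)`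
  have hS : (κ : ℤ) * sStarD A B C = ∑ x, g x * (N x : ℤ) := by
    rw [hSg, Finset.mul_sum]
    have h1 : ∀ r ∈ C, (κ : ℤ) * g r = ∑ x, if (∀ a ∈ J, x a = r a) then g x else 0 := by
      intro r _
      rw [← Finset.sum_filter, Finset.sum_congr rfl fun x hx => hg x r (Finset.mem_filter.1 hx).2, Finset.sum_const, hκ r]
      simp
    rw [Finset.sum_congr rfl h1, Finset.sum_comm]
    refine Finset.sum_congr rfl fun x _ => ?_
    have hN : (N x : ℤ) = ∑ r ∈ C, if (∀ a ∈ J, x a = r a) then (1:ℤ) else 0 := by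
      have e : (C.filter fun r : Pd d => ∀ a ∈ J, r a = x a) = C.filter fun r => ∀ a ∈ J, x a = r a :=
        Finset.filter_congr fun r _ => ⟨fun h a ha => (h a ha).symm, fun h a ha => (h a ha).symm⟩
      rw [hNdef, e, Finset.sum_boole]
    rw [hN, Finset.mul_sum]
    refine Finset.sum_congr rfl fun r _ => ?_
    split_ifs <;> simp
  -- the level sets `U_t = {r : t < N r}` are `J`-measurable up-sets, so `Σ_r [t < N r] g r ≥ 0`
  have hU : ∀ t : ℕ, 0 ≤ ∑ r, (if t < N r then g r else 0) := by
    intro t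
    rw [← Finset.sum_filter, ← hSg]
    refine hgood _ (fun r s hrs hr => ?_) (fun x y hxy => ?_)
    · rw [Finset.mem_coe, Finset.mem_filter] at hr ⊢
      refine ⟨Finset.mem_univ _, lt_of_lt_of_le hr.2 ?_⟩
      rw [hNdef, hNdef]; exact fibreCount_mono J hC hrs
    · rw [Finset.mem_filter, Finset.mem_filter]
      simp only [Finset.mem_univ, true_and]
      have : N x = N y := by
        rw [hNdef, hNdef]
        congr 1
        exact Finset.filter_congr fun r _ =>
          ⟨fun h a ha => (h a ha).trans (hxy a ha), fun h a ha => (h a ha).trans (hxy a ha).symm⟩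
      rw [this]
  -- layer cake
  have hlayer : ∀ r, g r * (N r : ℤ) = ∑ t ∈ Finset.range C.card, if t < N r then g r else 0 := by
    intro r
    have hle : N r ≤ C.card := by rw [hNdef]; exact Finset.card_le_card (Finset.filter_subset _ _)
    have e : (Finset.range C.card).filter (fun t => t < N r) = Finset.range (N r) := by
      ext t; simp only [Finset.mem_filter, Finset.mem_range]
      exact ⟨fun h => h.2, fun h => ⟨lt_of_lt_of_le h hle, h⟩⟩
    rw [← Finset.sum_filter, e, Finset.sum_const, Finset.card_range]
    simp [mul_comm]
  have htot : 0 ≤ ∑ r, g r * (N r : ℤ) := by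
    rw [Finset.sum_congr rfl fun r _ => hlayer r, Finset.sum_comm]
    exact Finset.sum_nonneg fun t _ => hU t
  rw [← hS] at htot
  exact nonneg_of_mul_nonneg_right (by rwa [mul_comm] at htot) (by exact_mod_cast hκpos)

end Summit.CriticalPhenomena.PercolationContinuityZ3.Theorems.SahiGridPattern
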